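import Summits.QuantumFields.GaugeBoot.BootstrapCertificates
import Mathlib.Analysis.Matrix.Order
import HarnessLib

/-!
# Gram-matrix form of the certificates: a positive semidefinite matrix on a family of test functions IS a sum of squares (gauge-boot, L1/L4 supplement)

HONEST FRAMING (cell `pub-gaugeboot`, page 1 of every file): the venture produces certified bounds
on lattice expectations at stated coupling, gauge group, dimension and torus size; NOT a mass gap,
NOT a continuum limit, NOT a string tension; NOT Yang–Mills-summit-bearing (barriers
`FixedCouplingUltralocality`, `PerturbativeInvisibility`). Linear algebra only; it certifies no
number.

## Content (the format of an actual dual SDP certificate)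

A dual solution of the level-`n` SDP — the object the cell's `certsdp` certificates and their Lean
replays (`Certificates/*.lean`) carry — is a positive semidefinite GRAM MATRIX `Q` indexed by a
finite family `m` of test functions together with row multipliers, and the certified identity is
`c • 1 - P = Σ_{ij} Q_{ij} m_i m_j + ρ`. This file identifies that format with the certificate cone
of `BootstrapCertificates.lean`:

* `gramForm m Q = Σ_{ij} Q_{ij} • (m_i m_j)`, linear in `Q`;
* ★ `gramForm_mem_sosCone` — `Q` positive semidefinite ⇒ `gramForm m Q` is a non-negative
  combination of squares of elements of any subspace containing the `m_i` (`Q` is a sum of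
  `Bᵀ B`, Mathlib's star-ordered-ring structure on real matrices, and
  `Σ_{ij} (BᵀB)_{ij} m_i m_j = Σ_k (Σ_i B_{ki} m_i)²`);
* ★ `exists_posSemidef_of_mem_sosCone` — conversely every element of the SOS cone of the span of
  the `m_i` is `gramForm m Q` for some PSD `Q` (rank-one matrices `c cᵀ`, sums, scalings);
* ★★ `mem_certCone_iff_exists_gram` — so `x ∈ certCone (span m)` iff
  `x = gramForm m Q + ρ` with `Q` PSD and `ρ` in the row space: PSD-GRAM-MATRIX CERTIFICATES ARE
  EXACTLY THE SOS ⊕ ROWS CERTIFICATES; with `BootstrapCertificates` / `…Completeness` they are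
  sound for every feasible functional and complete for every valid strict bound;
  `apply_le_of_gram_certificate` — the soundness statement in Gram form for any test set
  containing the family.

References: Blekherman–Parrilo–Thomas, Semidefinite Optimization and Convex Algebraic Geometry
(2012) §3.1 (Gram-matrix method); the cell's CERT-SDP format. Folklore.
-/

noncomputable section

open scoped MatrixOrder
open Matrix
open Literature.MathematicalPhysics.QuantumFieldTheory (LatticeRep)

namespace Summit.QuantumFields.GaugeBoot

open OrderUnitDuality

/-! ## Gram forms -/

section Gram

variable {ι : Type*} {G : Type*} [TopologicalSpace G] {σ : Type*} [Fintype σ]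

/-- **The Gram form** `Σ_{ij} Q_{ij} • (m_i m_j)` of a matrix `Q` on a finite family `m` of
observables. [folklore] -/
def gramForm (m : σ → C(ι → G, ℝ)) (Q : Matrix σ σ ℝ) : C(ι → G, ℝ) :=
  ∑ i, ∑ j, Q i j • (m i * m j)

/-- `gramForm` is additive in the matrix. -/
theorem gramForm_add (m : σ → C(ι → G, ℝ)) (Q Q' : Matrix σ σ ℝ) :
    gramForm m (Q + Q') = gramForm m Q + gramForm m Q' := by
  simp only [gramForm, Matrix.add_apply, add_smul, Finset.sum_add_distrib]

/-- `gramForm` is homogeneous in the matrix. -/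
theorem gramForm_smul (m : σ → C(ι → G, ℝ)) (c : ℝ) (Q : Matrix σ σ ℝ) :
    gramForm m (c • Q) = c • gramForm m Q := by
  simp only [gramForm, Matrix.smul_apply, smul_eq_mul, mul_smul, Finset.smul_sum]

/-- `gramForm` of the zero matrix. -/
theorem gramForm_zero (m : σ → C(ι → G, ℝ)) : gramForm m (0 : Matrix σ σ ℝ) = 0 := by
  simp only [gramForm, Matrix.zero_apply, zero_smul, Finset.sum_const_zero]

/-- **Rank one**: `gramForm m (c cᵀ) = (Σ_i c_i m_i)²`. -/
theorem gramForm_vecMulVec (m : σ → C(ι → G, ℝ)) (c : σ → ℝ) :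
    gramForm m (vecMulVec c c) = (∑ i, c i • m i) * (∑ i, c i • m i) := by
  rw [gramForm, Finset.sum_mul_sum]
  refine Finset.sum_congr rfl fun i _ => Finset.sum_congr rfl fun j _ => ?_
  rw [vecMulVec_apply, smul_mul_smul_comm]

/-- **`Bᵀ B`**: `gramForm m (Bᵀ B) = Σ_k (Σ_i B_{ki} m_i)²`. -/
theorem gramForm_transpose_mul_self {τ : Type*} [Fintype τ] (m : σ → C(ι → G, ℝ))
    (B : Matrix τ σ ℝ) :
    gramForm m (Bᵀ * B) = ∑ k, (∑ i, B k i • m i) * (∑ i, B k i • m i) := by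
  classical
  have h : Bᵀ * B = ∑ k, vecMulVec (fun i => B k i) (fun i => B k i) := by
    ext i j
    simp only [Matrix.mul_apply, Matrix.transpose_apply, Matrix.sum_apply, vecMulVec_apply]
  rw [h]
  have hsum : ∀ (s : Finset τ), gramForm m (∑ k ∈ s, vecMulVec (fun i => B k i) (fun i => B k i)) =
      ∑ k ∈ s, (∑ i, B k i • m i) * (∑ i, B k i • m i) := by
    intro s
    induction s using Finset.induction_on with
    | empty => rw [Finset.sum_empty, Finset.sum_empty, gramForm_zero]
    | insert a s ha ih => rw [Finset.sum_insert ha, Finset.sum_insert ha, gramForm_add, ih,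
        gramForm_vecMulVec]
  exact hsum Finset.univ

/-- A rank-one matrix `c cᵀ` is positive semidefinite. -/
theorem posSemidef_vecMulVec_self_real (c : σ → ℝ) : (vecMulVec c c).PosSemidef := by
  refine PosSemidef.of_dotProduct_mulVec_nonneg ?_ fun x => ?_
  · ext i j
    simp [vecMulVec_apply, mul_comm]
  · have h : star x ⬝ᵥ (vecMulVec c c *ᵥ x) = (∑ i, c i * x i) * ∑ j, c j * x j := by
      rw [Finset.sum_mul_sum]
      simp only [dotProduct, mulVec, vecMulVec_apply, star_trivial, Finset.mul_sum]
      exact Finset.sum_congr rfl fun i _ => Finset.sum_congr rfl fun j _ => by ring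
    rw [h]
    exact mul_self_nonneg _

/-! ## PSD Gram matrices give sums of squares, and conversely -/

/-- ★ **A positive semidefinite Gram matrix is a sum of squares**: for `Q` PSD and a subspace `W`
containing the family `m`, `Σ_{ij} Q_{ij} m_i m_j ∈ sosCone W`. [folklore] -/
theorem gramForm_mem_sosCone [DecidableEq σ] (m : σ → C(ι → G, ℝ)) (W : Submodule ℝ C(ι → G, ℝ))
    (hm : ∀ i, m i ∈ W) {Q : Matrix σ σ ℝ} (hQ : Q.PosSemidef) :
    gramForm m Q ∈ sosCone (W : Set C(ι → G, ℝ)) := by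
  have hQ' : (0 : Matrix σ σ ℝ) ≤ Q := Matrix.nonneg_iff_posSemidef.2 hQ
  rw [StarOrderedRing.nonneg_iff] at hQ'
  clear hQ
  induction hQ' using AddSubmonoid.closure_induction with
  | mem Q₁ hQ₁ =>
    obtain ⟨B, rfl⟩ := Set.mem_range.1 hQ₁
    rw [show star B * B = Bᵀ * B by rw [Matrix.star_eq_conjTranspose]; rfl,
      gramForm_transpose_mul_self]
    exact Submodule.sum_mem _ fun k _ => mul_self_mem_sosCone
      (W.sum_mem fun i _ => W.smul_mem _ (hm i))
  | zero => rw [gramForm_zero]; exact Submodule.zero_mem _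
  | add Q₁ Q₂ _ _ h₁ h₂ => rw [gramForm_add]; exact Submodule.add_mem _ h₁ h₂

/-- ★ **Every sum of squares over the span of a finite family is a PSD Gram form.** [folklore] -/
theorem exists_posSemidef_of_mem_sosCone [DecidableEq σ] (m : σ → C(ι → G, ℝ)) {x : C(ι → G, ℝ)}
    (hx : x ∈ sosCone (Submodule.span ℝ (Set.range m) : Set C(ι → G, ℝ))) :
    ∃ Q : Matrix σ σ ℝ, Q.PosSemidef ∧ gramForm m Q = x := by
  induction hx using Submodule.span_induction with
  | mem y hy =>
    obtain ⟨v, hv, rfl⟩ := hy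
    obtain ⟨c, rfl⟩ := (Submodule.mem_span_range_iff_exists_fun ℝ).1 hv
    exact ⟨vecMulVec c c, posSemidef_vecMulVec_self_real c, gramForm_vecMulVec m c⟩
  | zero => exact ⟨0, PosSemidef.zero, gramForm_zero m⟩
  | add x y _ _ hx hy =>
    obtain ⟨Q, hQ, rfl⟩ := hx
    obtain ⟨Q', hQ', rfl⟩ := hy
    exact ⟨Q + Q', hQ.add hQ', gramForm_add m Q Q'⟩
  | smul c x _ hx =>
    obtain ⟨Q, hQ, rfl⟩ := hx
    refine ⟨(c : ℝ) • Q, hQ.smul c.2, ?_⟩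
    rw [gramForm_smul]
    rfl

/-- ★ **SOS cone of a span = PSD Gram forms.** [folklore] -/
theorem mem_sosCone_span_iff_exists_posSemidef [DecidableEq σ] (m : σ → C(ι → G, ℝ))
    {x : C(ι → G, ℝ)} :
    x ∈ sosCone (Submodule.span ℝ (Set.range m) : Set C(ι → G, ℝ)) ↔
      ∃ Q : Matrix σ σ ℝ, Q.PosSemidef ∧ gramForm m Q = x := by
  refine ⟨exists_posSemidef_of_mem_sosCone m, ?_⟩
  rintro ⟨Q, hQ, rfl⟩
  exact gramForm_mem_sosCone m _ (fun i => Submodule.subset_span (Set.mem_range_self i)) hQ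

end Gram

/-! ## Gram certificates are the SOS ⊕ rows certificates -/

section Cert

variable {ι : Type*} [DecidableEq ι] {G : Type*} [Group G] [TopologicalSpace G] (r : LatticeRep G)
  {K : Type*} {k : K → ℝ → G} {S : ι → (ι → G) → ℝ} {β : ℝ} {σ : Type*} [Fintype σ] [DecidableEq σ]

/-- ★★ **PSD-Gram-matrix certificates are exactly the certificate-cone memberships** (test space =
the span of the family `m`): `x ∈ certCone` iff `x = Σ_{ij} Q_{ij} m_i m_j + ρ` with `Q` positive
semidefinite and `ρ` a combination of row elements. [folklore] -/
theorem mem_certCone_iff_exists_gram (m : σ → C(ι → G, ℝ)) {x : C(ι → G, ℝ)} :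
    x ∈ certCone r k S β (Submodule.span ℝ (Set.range m) : Set C(ι → G, ℝ)) ↔
      ∃ Q : Matrix σ σ ℝ, Q.PosSemidef ∧
        ∃ ρ ∈ rowSpace r k S β (Submodule.span ℝ (Set.range m) : Set C(ι → G, ℝ)),
          gramForm m Q + ρ = x := by
  rw [mem_certCone_iff]
  constructor
  · rintro ⟨s, hs, ρ, hρ, rfl⟩
    obtain ⟨Q, hQ, rfl⟩ := exists_posSemidef_of_mem_sosCone m hs
    exact ⟨Q, hQ, ρ, hρ, rfl⟩
  · rintro ⟨Q, hQ, ρ, hρ, rfl⟩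
    exact ⟨gramForm m Q, (mem_sosCone_span_iff_exists_posSemidef m).2 ⟨Q, hQ, rfl⟩, ρ, hρ, rfl⟩

/-- ★★ **A Gram certificate over any test set containing the family is a certificate**: if the
`m_i` lie in a subspace `W`, `Q` is PSD and `ρ` is in the row space of `W`, then
`Σ Q_{ij} m_i m_j + ρ ∈ certCone W`. [folklore] -/
theorem gram_add_mem_certCone (m : σ → C(ι → G, ℝ)) (W : Submodule ℝ C(ι → G, ℝ))
    (hm : ∀ i, m i ∈ W) {Q : Matrix σ σ ℝ} (hQ : Q.PosSemidef) {ρ : C(ι → G, ℝ)}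
    (hρ : ρ ∈ rowSpace r k S β (W : Set C(ι → G, ℝ))) :
    gramForm m Q + ρ ∈ certCone r k S β (W : Set C(ι → G, ℝ)) :=
  (mem_certCone_iff r).2 ⟨gramForm m Q, gramForm_mem_sosCone m W hm hQ, ρ, hρ, rfl⟩

end Cert

section Sound

variable {ι : Type*} [DecidableEq ι] [Countable ι] {G : Type*} [Group G] [TopologicalSpace G]
  [IsTopologicalGroup G] [CompactSpace G] [MeasurableSpace G] [BorelSpace G]
  [SecondCountableTopology G] (r : LatticeRep G) {K : Type*}
  {k : K → ℝ → G} {S : ι → (ι → G) → ℝ} {β : ℝ} {σ : Type*} [Fintype σ] [DecidableEq σ]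

omit [Countable ι] [IsTopologicalGroup G] [CompactSpace G] [MeasurableSpace G] [BorelSpace G]
  [SecondCountableTopology G] in
/-- ★★ **Soundness in Gram form**: an identity `c • 1 - P = Σ_{ij} Q_{ij} m_i m_j + ρ` with `Q`
PSD, the `m_i` test functions and `ρ` a row combination proves `φ P ≤ c` for every feasible `φ`
— the statement a kernel-replayed `certsdp` certificate instantiates. [folklore] -/
theorem apply_le_of_gram_certificate (m : σ → C(ι → G, ℝ)) (W : Submodule ℝ C(ι → G, ℝ))
    (hm : ∀ i, m i ∈ W) {Q : Matrix σ σ ℝ} (hQ : Q.PosSemidef) {ρ : C(ι → G, ℝ)}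
    (hρ : ρ ∈ rowSpace r k S β (W : Set C(ι → G, ℝ))) {P : C(ι → G, ℝ)} {c : ℝ}
    (hcert : gramForm m Q + ρ = c • (1 : C(ι → G, ℝ)) - P)
    {φ : C(ι → G, ℝ) →ₗ[ℝ] ℝ} (hφ : IsBootstrapFeasible r k S β (W : Set C(ι → G, ℝ)) φ) :
    φ P ≤ c :=
  hφ.apply_le_of_mem_certCone r (hcert ▸ gram_add_mem_certCone r m W hm hQ hρ)

omit [Countable ι] [IsTopologicalGroup G] [CompactSpace G] [MeasurableSpace G] [BorelSpace G]
  [SecondCountableTopology G] in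
/-- ★★ **Soundness in Gram form, lower bounds**: `P - c • 1 = Σ Q_{ij} m_i m_j + ρ` proves
`c ≤ φ P`. [folklore] -/
theorem le_apply_of_gram_certificate (m : σ → C(ι → G, ℝ)) (W : Submodule ℝ C(ι → G, ℝ))
    (hm : ∀ i, m i ∈ W) {Q : Matrix σ σ ℝ} (hQ : Q.PosSemidef) {ρ : C(ι → G, ℝ)}
    (hρ : ρ ∈ rowSpace r k S β (W : Set C(ι → G, ℝ))) {P : C(ι → G, ℝ)} {c : ℝ}
    (hcert : gramForm m Q + ρ = P - c • (1 : C(ι → G, ℝ)))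
    {φ : C(ι → G, ℝ) →ₗ[ℝ] ℝ} (hφ : IsBootstrapFeasible r k S β (W : Set C(ι → G, ℝ)) φ) :
    c ≤ φ P :=
  hφ.le_apply_of_mem_certCone r (hcert ▸ gram_add_mem_certCone r m W hm hQ hρ)

end Sound

end Summit.QuantumFields.GaugeBoot

end
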